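import Mathlib.Analysis.SpecialFunctions.Pow.Real
import Mathlib.Analysis.SpecialFunctions.Sqrt
import Mathlib.Analysis.Complex.Basic
import Mathlib.Order.Interval.Finset.Nat
import HarnessLib

/-!
# Route `PrimeLevelFamEdge`, crux K_A `MomentsBeyondDiagonal` (stmt-Parity-20007), line «petersson_layers» v4:
# the AFE-SIDE coefficients of a regrouped layer form — their `ℓ²(box)` size from a sup bound on the weight

In the `k`-th separated form of a truncated Petersson layer block (`…LayersTruncatedBlock`) the AFE-side table is
`B(n₁, n₂) = w(d₁n₁, d₂n₂) · (√n₁)^{2k+1}(√n₂)^{2k+1}`, `w(n₁, n₂) = (n₁n₂)^{−1/2} W_{ij}(q̂; n₁, n₂)`.  In the AFE-effective box the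
two-order weight is bounded by log powers (the tree's `norm_afeW_le_logsep` at `A = 0`, or `…_le_rpow`), i.e.
`‖w(n₁,n₂)‖·√(n₁n₂) ≤ W_max` there.  This file turns ANY such sup bound into the `ℓ²(box)` bound the bilinear estimates consume
(`…LayersBlockFourierBound`, `…LayersBlockPascadiBound` via `…LayersConvolutionL2`):
* `norm_afePair_le` — `‖B(n₁,n₂)‖ ≤ W_max (d₁d₂)^{−1/2} (n₁n₂)^k`;
* `norm_sq_sum_afePair_le` — `Σ_{n₁≤Y₁, n₂≤Y₂} ‖B(n₁,n₂)‖² ≤ W_max² (d₁d₂)⁻¹ Y₁^{2k+1} Y₂^{2k+1}`.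
Generic in the weight `w : ℕ → ℕ → ℂ` (no AFE object is imported).  Companion of `…LayersMollifierSideL2`.
Proof only (def-free helper toward `stub_farP` / `stub_band`); nothing about any layer, K_A or Landau–Siegel zeros is claimed.
-/

noncomputable section

open Finset

namespace Summit.Parity.GeneralizedHardyLittlewood.Theorems.MomentsBeyondDiagonal.Layers

/-- **Size of the AFE-side table from a sup bound**: if `‖w(d₁n₁, d₂n₂)‖ · √((d₁n₁)(d₂n₂)) ≤ W` then
`‖w(d₁n₁,d₂n₂) (√n₁)^{2k+1} (√n₂)^{2k+1}‖ ≤ W (d₁d₂)^{−1/2} (n₁ n₂)^k` (`dᵢ, nᵢ ≥ 1`). [folklore] -/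
theorem norm_afePair_le (w : ℕ → ℕ → ℂ) {W : ℝ} {d₁ d₂ n₁ n₂ : ℕ} (hd₁ : 0 < d₁) (hd₂ : 0 < d₂)
    (hn₁ : 0 < n₁) (hn₂ : 0 < n₂)
    (hw : ‖w (d₁ * n₁) (d₂ * n₂)‖ * Real.sqrt (((d₁ * n₁ : ℕ) : ℝ) * ((d₂ * n₂ : ℕ) : ℝ)) ≤ W) (k : ℕ) :
    ‖w (d₁ * n₁) (d₂ * n₂) * ((Real.sqrt n₁ ^ (2 * k + 1) * Real.sqrt n₂ ^ (2 * k + 1) : ℝ) : ℂ)‖ ≤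
      W * ((d₁ : ℝ) * d₂) ^ (-(1 / 2 : ℝ)) * ((n₁ : ℝ) ^ k * (n₂ : ℝ) ^ k) := by
  have hd₁0 : (0 : ℝ) < d₁ := by exact_mod_cast hd₁
  have hd₂0 : (0 : ℝ) < d₂ := by exact_mod_cast hd₂
  have hn₁0 : (0 : ℝ) < n₁ := by exact_mod_cast hn₁
  have hn₂0 : (0 : ℝ) < n₂ := by exact_mod_cast hn₂
  have hdd : (0 : ℝ) < (d₁ : ℝ) * d₂ := mul_pos hd₁0 hd₂0
  rw [norm_mul, Complex.norm_real, Real.norm_eq_abs,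
    abs_of_nonneg (mul_nonneg (pow_nonneg (Real.sqrt_nonneg _) _) (pow_nonneg (Real.sqrt_nonneg _) _))]
  -- `(√n₁)^{2k+1}(√n₂)^{2k+1} = (n₁n₂)^k · √(n₁n₂)` and `√((d₁n₁)(d₂n₂)) = √(d₁d₂) · √(n₁n₂)`
  have hsq : Real.sqrt n₁ ^ (2 * k + 1) * Real.sqrt n₂ ^ (2 * k + 1) =
      ((n₁ : ℝ) ^ k * (n₂ : ℝ) ^ k) * Real.sqrt ((n₁ : ℝ) * n₂) := by
    rw [pow_succ, pow_succ, pow_mul, pow_mul, Real.sq_sqrt hn₁0.le, Real.sq_sqrt hn₂0.le,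
      Real.sqrt_mul hn₁0.le]
    ring
  have hbig : Real.sqrt (((d₁ * n₁ : ℕ) : ℝ) * ((d₂ * n₂ : ℕ) : ℝ)) =
      Real.sqrt ((d₁ : ℝ) * d₂) * Real.sqrt ((n₁ : ℝ) * n₂) := by
    rw [← Real.sqrt_mul hdd.le]
    congr 1
    push_cast
    ring
  have hW0 : 0 ≤ W := le_trans (by positivity) hw
  have hsnn : 0 < Real.sqrt ((n₁ : ℝ) * n₂) := Real.sqrt_pos.mpr (mul_pos hn₁0 hn₂0)
  have hsdd : 0 < Real.sqrt ((d₁ : ℝ) * d₂) := Real.sqrt_pos.mpr hdd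
  -- from `hw`: `‖w‖ √(n₁n₂) ≤ W / √(d₁d₂) = W (d₁d₂)^{-1/2}`
  have hw' : ‖w (d₁ * n₁) (d₂ * n₂)‖ * Real.sqrt ((n₁ : ℝ) * n₂) ≤ W * ((d₁ : ℝ) * d₂) ^ (-(1 / 2 : ℝ)) := by
    rw [hbig] at hw
    rw [Real.rpow_neg hdd.le, ← Real.sqrt_eq_rpow, ← div_eq_mul_inv, le_div_iff₀ hsdd]
    calc ‖w (d₁ * n₁) (d₂ * n₂)‖ * Real.sqrt ((n₁ : ℝ) * n₂) * Real.sqrt ((d₁ : ℝ) * d₂)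
        = ‖w (d₁ * n₁) (d₂ * n₂)‖ * (Real.sqrt ((d₁ : ℝ) * d₂) * Real.sqrt ((n₁ : ℝ) * n₂)) := by ring
      _ ≤ W := hw
  calc ‖w (d₁ * n₁) (d₂ * n₂)‖ * (Real.sqrt n₁ ^ (2 * k + 1) * Real.sqrt n₂ ^ (2 * k + 1))
      = (‖w (d₁ * n₁) (d₂ * n₂)‖ * Real.sqrt ((n₁ : ℝ) * n₂)) * ((n₁ : ℝ) ^ k * (n₂ : ℝ) ^ k) := by
        rw [hsq]; ring
    _ ≤ (W * ((d₁ : ℝ) * d₂) ^ (-(1 / 2 : ℝ))) * ((n₁ : ℝ) ^ k * (n₂ : ℝ) ^ k) :=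
        mul_le_mul_of_nonneg_right hw' (by positivity)
    _ = W * ((d₁ : ℝ) * d₂) ^ (-(1 / 2 : ℝ)) * ((n₁ : ℝ) ^ k * (n₂ : ℝ) ^ k) := by ring

/-- **`ℓ²(box)` bound for the AFE-side table from a sup bound on the weight in the box**:
if `‖w(d₁n₁,d₂n₂)‖ √((d₁n₁)(d₂n₂)) ≤ W` for all `n₁ ≤ Y₁`, `n₂ ≤ Y₂`, then
`Σ_{n₁≤Y₁, n₂≤Y₂} ‖w(d₁n₁,d₂n₂)(√n₁)^{2k+1}(√n₂)^{2k+1}‖² ≤ W² (d₁d₂)⁻¹ Y₁^{2k+1} Y₂^{2k+1}`. [folklore] -/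
theorem norm_sq_sum_afePair_le (w : ℕ → ℕ → ℂ) {W : ℝ} {d₁ d₂ Y₁ Y₂ : ℕ} (hd₁ : 0 < d₁) (hd₂ : 0 < d₂)
    (hw : ∀ n₁ ∈ Icc 1 Y₁, ∀ n₂ ∈ Icc 1 Y₂,
      ‖w (d₁ * n₁) (d₂ * n₂)‖ * Real.sqrt (((d₁ * n₁ : ℕ) : ℝ) * ((d₂ * n₂ : ℕ) : ℝ)) ≤ W) (k : ℕ) :
    ∑ p ∈ Icc 1 Y₁ ×ˢ Icc 1 Y₂,
        ‖w (d₁ * p.1) (d₂ * p.2) * ((Real.sqrt p.1 ^ (2 * k + 1) * Real.sqrt p.2 ^ (2 * k + 1) : ℝ) : ℂ)‖ ^ 2 ≤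
      W ^ 2 * ((d₁ : ℝ) * d₂)⁻¹ * ((Y₁ : ℝ) ^ (2 * k + 1) * (Y₂ : ℝ) ^ (2 * k + 1)) := by
  have hd₁0 : (0 : ℝ) < d₁ := by exact_mod_cast hd₁
  have hd₂0 : (0 : ℝ) < d₂ := by exact_mod_cast hd₂
  have hdd : (0 : ℝ) < (d₁ : ℝ) * d₂ := mul_pos hd₁0 hd₂0
  rcases (Icc 1 Y₁ ×ˢ Icc 1 Y₂).eq_empty_or_nonempty with he | ⟨p₀, hp₀⟩
  · rw [he, Finset.sum_empty]
    positivity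
  have hW0 : 0 ≤ W := by
    simp only [mem_product] at hp₀
    exact le_trans (by positivity) (hw p₀.1 hp₀.1 p₀.2 hp₀.2)
  set Cst : ℝ := W * ((d₁ : ℝ) * d₂) ^ (-(1 / 2 : ℝ)) * ((Y₁ : ℝ) ^ k * (Y₂ : ℝ) ^ k) with hCst
  have hterm : ∀ p ∈ Icc 1 Y₁ ×ˢ Icc 1 Y₂,
      ‖w (d₁ * p.1) (d₂ * p.2) * ((Real.sqrt p.1 ^ (2 * k + 1) * Real.sqrt p.2 ^ (2 * k + 1) : ℝ) : ℂ)‖ ^ 2 ≤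
        Cst ^ 2 := by
    intro p hp
    simp only [mem_product, mem_Icc] at hp
    have hle := norm_afePair_le w hd₁ hd₂ hp.1.1 hp.2.1
      (hw p.1 (mem_Icc.mpr hp.1) p.2 (mem_Icc.mpr hp.2)) k
    have hmono : W * ((d₁ : ℝ) * d₂) ^ (-(1 / 2 : ℝ)) * ((p.1 : ℝ) ^ k * (p.2 : ℝ) ^ k) ≤ Cst := by
      rw [hCst]
      refine mul_le_mul_of_nonneg_left ?_ (by positivity)
      exact mul_le_mul (pow_le_pow_left₀ (Nat.cast_nonneg _) (by exact_mod_cast hp.1.2) k)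
        (pow_le_pow_left₀ (Nat.cast_nonneg _) (by exact_mod_cast hp.2.2) k) (by positivity) (by positivity)
    exact pow_le_pow_left₀ (norm_nonneg _) (hle.trans hmono) 2
  refine (Finset.sum_le_sum hterm).trans ?_
  rw [Finset.sum_const, Finset.card_product, Nat.card_Icc, Nat.card_Icc, nsmul_eq_mul]
  simp only [Nat.add_sub_cancel]
  rw [hCst]
  have hd : (((d₁ : ℝ) * d₂) ^ (-(1 / 2 : ℝ))) ^ 2 = ((d₁ : ℝ) * d₂)⁻¹ := by
    rw [← Real.rpow_natCast (((d₁ : ℝ) * d₂) ^ (-(1 / 2 : ℝ))), ← Real.rpow_mul hdd.le]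
    norm_num
    rw [Real.rpow_neg_one, mul_inv, mul_comm]
  push_cast
  rw [show (W * ((d₁ : ℝ) * d₂) ^ (-(1 / 2 : ℝ)) * ((Y₁ : ℝ) ^ k * (Y₂ : ℝ) ^ k)) ^ 2 =
      W ^ 2 * ((((d₁ : ℝ) * d₂) ^ (-(1 / 2 : ℝ))) ^ 2) * ((Y₁ : ℝ) ^ (2 * k) * (Y₂ : ℝ) ^ (2 * k)) by ring, hd]
  have : (Y₁ : ℝ) * Y₂ * (W ^ 2 * ((d₁ : ℝ) * d₂)⁻¹ * ((Y₁ : ℝ) ^ (2 * k) * (Y₂ : ℝ) ^ (2 * k))) =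
      W ^ 2 * ((d₁ : ℝ) * d₂)⁻¹ * ((Y₁ : ℝ) ^ (2 * k + 1) * (Y₂ : ℝ) ^ (2 * k + 1)) := by ring
  rw [this]

end Summit.Parity.GeneralizedHardyLittlewood.Theorems.MomentsBeyondDiagonal.Layers

end
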